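import Literature.AlgebraicGeometry.Motives.AbelianVarietyLatticeTensor
import HarnessLib

/-!
# Equivariance in coordinates for lattice tensors `Y ⊗_β M`: maps into / out of / between lattice tensors are `G`-maps iff their
# components satisfy `σ(g) f_i = Σ_j m(g)_{ij} f_j β(g)`, `Σ_i m(g)_{ij} β(g) f^i = f^j σ'(g)`, `m(g) ⋆ F = F ⋆ n(g)`;
# fixed vectors `m(g) v = v` give the equivariant maps `y ↦ y ⊗ v`

Sequel of `Motives/AbelianVarietyLatticeTensor` (notation as there: `b` a bicone over `(Y)_{i ∈ ι}` with `Σ π_i ι_i = 𝟙`, action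
`ρ` with `ι_j ρ(g) π_i = m(g)_{ij} • β(g)`).  The universal properties of the lattice tensor — Jordan–Keeton–Poonen–Rains–
Shepherd-Barron–Tate §4.1: `Hom(C, 𝓗𝓸𝓶_R(M, E)) ≅ Hom_R(M, Hom(C, E))` and dually for `M ⊗_R E`; Mazur–Rubin–Silverberg Prop. 1.6:
`Hom(I ⊗ V, J ⊗ W) ≅ Hom_𝒪(I, J ⊗ Hom(V, W))`, under which the `G`-maps are the `G`-invariants — in the def-free coordinates of the
tree (the lattice analogue of `permPower_comm_iff_target/source`, `permPower_comm_iff` of `Motives/AbelianVarietyPermutationPowerHom`):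

* §1 MAPS INTO `Y ⊗_β M`: `f : X' → Y ⊗_β M` intertwines `σ` and `ρ` iff its components `f_i = f ≫ π_i` satisfy
  **`σ(g) ≫ f_i = Σ_j m(g)_{ij} • f_j ≫ β(g)`** (`comm_iff_target`) — "`(f_i)` is a `G`-fixed vector of `M ⊗ Hom(X', Y)`"; the invariant
  maps (`f ρ(g) = f`): `Σ_j m(g)_{ij} • f_j β(g) = f_i` (`comp_asHom_eq_self_iff`);
* §2 MAPS OUT OF `Y ⊗_β M`: `f : Y ⊗_β M → X'` intertwines iff the components `f^j = ι_j ≫ f` satisfy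
  **`Σ_i m(g)_{ij} • β(g) ≫ f^i = f^j ≫ σ'(g)`** (`comm_iff_source`); invariants (`ρ(g) f = f`): `Σ_i m(g)_{ij} • β(g) f^i = f^j`
  (`asHom_comp_eq_self_iff`);
* §3 MAPS BETWEEN lattice tensors `Y ⊗_β M → Y' ⊗_{β'} N`: equivariant iff the block matrix `F_{kj} = ι_j ≫ f ≫ π_k ∈ Hom(Y, Y')` satisfies
  **`Σ_i m(g)_{ij} • β(g) F_{ki} = Σ_l n(g)_{kl} • F_{lj} β'(g)`** (`comm_iff_blocks`; "`F m(g) = n(g) F`" twisted), with the membership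
  form for `Hom_G = ⨅_g eqLocus` (`mem_equivariantHom_iff_blocks`) — the `G`-invariants of `M^∨ ⊗ N ⊗ Hom(Y, Y')` (MRS Prop. 1.6 (ii));
* §4 FIXED VECTORS: a column vector `v ∈ ℤ^ι` with **`m(g) v = v`** gives the `G`-map **`y ↦ y ⊗ v = Σ_i v_i • ι_i : (Y, β) → Y ⊗_β M`**
  (`comm_sum_zsmul_ι_of_mulVec_eq`), a row vector `w` with `w m(g) = w` the `G`-map `Σ_i w_i • π_i : Y ⊗_β M → (Y, β)`
  (`comm_sum_zsmul_π_of_vecMul_eq`) — `M^G ⊗ V ↪ (M ⊗ V)`, e.g. the diagonal `Y → Y ⊗ ℤ[G/H]` and the trace `Y ⊗ ℤ[G/H] → Y`; more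
  generally an intertwiner `P ∈ Hom_{ℤ[G]}(M, N)` gives `P_Y` (the prequel `Motives/AbelianVarietyLatticeTensorIsogeny`).

Everything is a theorem; no definition, instance or notation.

## References

* [JordanEtAl2018] B. W. Jordan, A. G. Keeton, B. Poonen, E. M. Rains, N. Shepherd-Barron, J. T. Tate, *Abelian varieties isogenous
  to a power of an elliptic curve*, Compos. Math. 154 (2018), §4.1 (the functors `𝓗𝓸𝓶_R(−, E)`, `− ⊗_R E` and their universal
  properties; Remark 4.1).  arXiv:1602.06237 read 2026-08-28.
* [MazurRubinSilverberg2007] B. Mazur, K. Rubin, A. Silverberg, *Twisting commutative algebraic groups*, J. Algebra 314 (2007)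
  419–438: Prop. 1.6 (i) (`M_{m×n}(Hom(V, W)) ≅ Hom(V^n, W^m)`), (ii) (`Hom_{𝒪[G_k]}(I, J) ⊗ Hom_k(V, W)` inside `Hom_k(I ⊗ V, J ⊗ W)`),
  Cor. 1.7 (i) (`f ↦ f_V`).  Held: `paper:doi-10-1016-j-jalgebra-2007-02-052`, PDF pp. 4–5.
* [SerreLinearRepresentations1977] J.-P. Serre, *Linear Representations of Finite Groups*, GTM 42 (1977): §1.1 (`T R_s = R'_s T`), §1.5,
  §2.1 Prop. 2 (ii), §2.3 (invariants, `Hom_G(V, W) = Hom(V, W)^G`), Ex. 2.4 (PDF p. 16).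
* [MumfordAV1970] D. Mumford, *Abelian Varieties* (1970), §19 (p. 173: matrices of homomorphisms between products).
-/

noncomputable section

open CategoryTheory CategoryTheory.Limits
open Literature.NumberTheory.DiophantineGeometry
open Literature.RepresentationTheory.FiniteGroups

universe u

namespace Literature.AlgebraicGeometry.Motives

namespace AbelianVariety

namespace LatticeTensor

variable {K : Type u} [Field K]

section Coordinates

variable {Y Y' X' : AbelianVariety K} {ι κ : Type} [Fintype ι] [Fintype κ] [DecidableEq ι] [DecidableEq κ]
  (b : Bicone (fun _ : ι ↦ Y)) (c : Bicone (fun _ : κ ↦ Y')) {G : Type} [Group G]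
  (m : G →* Matrix ι ι ℤ) (n : G →* Matrix κ κ ℤ) (β : G →* End Y) (β' : G →* End Y')
  (ρ : G →* End b.pt) (ρ' : G →* End c.pt) (σ : G →* End X')

/-! ## §1 Maps into `Y ⊗_β M` -/

/-- **Maps INTO a lattice tensor**: `f : X' → Y ⊗_β M` is `G`-equivariant (`σ(g) ≫ f = f ≫ ρ(g)`) iff its components `f_i = f ≫ π_i`
satisfy **`σ(g) ≫ f_i = Σ_j m(g)_{ij} • (f_j ≫ β(g))`** — the vector `(f_i) ∈ M ⊗ Hom(X', Y)` is `G`-fixed for the diagonal action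
(`Hom(C, 𝓗𝓸𝓶(M^∨, Y))^G = Hom_{ℤ[G]}(M^∨, Hom(C, Y))`). [cite: JordanEtAl2018, §4.1 (`Hom(C, 𝓗𝓸𝓶_R(M, E)) ≅ Hom_R(M, Hom(C, E))`)]
[cite: MazurRubinSilverberg2007, Prop. 1.6 (ii)] [cite: SerreLinearRepresentations1977, §2.3] -/
theorem comm_iff_target (hb : ∑ j, b.π j ≫ b.ι j = 𝟙 b.pt)
    (hρ : ∀ (g : G) (i j : ι), b.ι j ≫ End.asHom (ρ g) ≫ b.π i = m g i j • End.asHom (β g)) (f : X' ⟶ b.pt) :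
    (∀ g : G, End.asHom (σ g) ≫ f = f ≫ End.asHom (ρ g)) ↔
      ∀ (g : G) (i : ι), End.asHom (σ g) ≫ f ≫ b.π i = ∑ j, m g i j • ((f ≫ b.π j) ≫ End.asHom (β g)) := by
  have key : ∀ (g : G) (i : ι), (f ≫ End.asHom (ρ g)) ≫ b.π i = ∑ j, m g i j • ((f ≫ b.π j) ≫ End.asHom (β g)) := by
    intro g i
    rw [Category.assoc, asHom_comp_π_eq_sum b m β ρ hb hρ g i, Preadditive.comp_sum]
    exact Finset.sum_congr rfl fun j _ ↦ by rw [Preadditive.comp_zsmul, Category.assoc]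
  constructor
  · intro h g i
    rw [← Category.assoc, h g, key g i]
  · intro h g
    refine hom_ext_π b hb fun i ↦ ?_
    rw [Category.assoc, h g i, key g i]

/-- **`G`-invariant maps into `Y ⊗_β M`** (`f ≫ ρ(g) = f` for all `g`): iff **`Σ_j m(g)_{ij} • (f_j ≫ β(g)) = f_i`** — the vector of
components is fixed by `m(g) ⊗ β(g)`. [cite: JordanEtAl2018, §4.1] [cite: SerreLinearRepresentations1977, §2.3 (`V^G`)] -/
theorem comp_asHom_eq_self_iff (hb : ∑ j, b.π j ≫ b.ι j = 𝟙 b.pt)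
    (hρ : ∀ (g : G) (i j : ι), b.ι j ≫ End.asHom (ρ g) ≫ b.π i = m g i j • End.asHom (β g)) (f : X' ⟶ b.pt) :
    (∀ g : G, f ≫ End.asHom (ρ g) = f) ↔
      ∀ (g : G) (i : ι), ∑ j, m g i j • ((f ≫ b.π j) ≫ End.asHom (β g)) = f ≫ b.π i := by
  have key : ∀ (g : G) (i : ι), (f ≫ End.asHom (ρ g)) ≫ b.π i = ∑ j, m g i j • ((f ≫ b.π j) ≫ End.asHom (β g)) := by
    intro g i
    rw [Category.assoc, asHom_comp_π_eq_sum b m β ρ hb hρ g i, Preadditive.comp_sum]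
    exact Finset.sum_congr rfl fun j _ ↦ by rw [Preadditive.comp_zsmul, Category.assoc]
  constructor
  · intro h g i
    rw [← key g i, h g]
  · intro h g
    refine hom_ext_π b hb fun i ↦ ?_
    rw [key g i, h g i]

/-! ## §2 Maps out of `Y ⊗_β M` -/

/-- **Maps OUT OF a lattice tensor**: `f : Y ⊗_β M → X'` is `G`-equivariant (`ρ(g) ≫ f = f ≫ σ'(g)`) iff its components `f^j = ι_j ≫ f`
satisfy **`Σ_i m(g)_{ij} • (β(g) ≫ f^i) = f^j ≫ σ'(g)`** (`Hom(M ⊗ Y, C)^G = Hom_{ℤ[G]}(M, Hom(Y, C))`).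
[cite: JordanEtAl2018, §4.1 and Remark 4.1 (`M ⊗_R E`)] [cite: MazurRubinSilverberg2007, Prop. 1.6 (ii)] [cite: SerreLinearRepresentations1977, §2.3] -/
theorem comm_iff_source (hb : ∑ j, b.π j ≫ b.ι j = 𝟙 b.pt)
    (hρ : ∀ (g : G) (i j : ι), b.ι j ≫ End.asHom (ρ g) ≫ b.π i = m g i j • End.asHom (β g)) (f : b.pt ⟶ X') :
    (∀ g : G, End.asHom (ρ g) ≫ f = f ≫ End.asHom (σ g)) ↔
      ∀ (g : G) (j : ι), ∑ i, m g i j • (End.asHom (β g) ≫ b.ι i ≫ f) = (b.ι j ≫ f) ≫ End.asHom (σ g) := by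
  have key : ∀ (g : G) (j : ι), b.ι j ≫ End.asHom (ρ g) ≫ f = ∑ i, m g i j • (End.asHom (β g) ≫ b.ι i ≫ f) := by
    intro g j
    rw [← Category.assoc, ι_comp_asHom_eq_sum b m β ρ hb hρ g j, Preadditive.sum_comp]
    exact Finset.sum_congr rfl fun i _ ↦ by rw [Preadditive.zsmul_comp, Category.assoc]
  constructor
  · intro h g j
    rw [← key g j, h g, Category.assoc]
  · intro h g
    refine hom_ext_ι b hb fun j ↦ ?_
    rw [key g j, h g j, Category.assoc]

/-- **`G`-invariant maps out of `Y ⊗_β M`** (`ρ(g) ≫ f = f`): iff **`Σ_i m(g)_{ij} • (β(g) ≫ f^i) = f^j`**.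
[cite: JordanEtAl2018, §4.1] [cite: SerreLinearRepresentations1977, §2.3] -/
theorem asHom_comp_eq_self_iff (hb : ∑ j, b.π j ≫ b.ι j = 𝟙 b.pt)
    (hρ : ∀ (g : G) (i j : ι), b.ι j ≫ End.asHom (ρ g) ≫ b.π i = m g i j • End.asHom (β g)) (f : b.pt ⟶ X') :
    (∀ g : G, End.asHom (ρ g) ≫ f = f) ↔
      ∀ (g : G) (j : ι), ∑ i, m g i j • (End.asHom (β g) ≫ b.ι i ≫ f) = b.ι j ≫ f := by
  have key : ∀ (g : G) (j : ι), b.ι j ≫ End.asHom (ρ g) ≫ f = ∑ i, m g i j • (End.asHom (β g) ≫ b.ι i ≫ f) := by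
    intro g j
    rw [← Category.assoc, ι_comp_asHom_eq_sum b m β ρ hb hρ g j, Preadditive.sum_comp]
    exact Finset.sum_congr rfl fun i _ ↦ by rw [Preadditive.zsmul_comp, Category.assoc]
  constructor
  · intro h g j
    rw [← key g j, h g]
  · intro h g
    refine hom_ext_ι b hb fun j ↦ ?_
    rw [key g j, h g j]

/-! ## §3 Maps between lattice tensors: `m(g) ⋆ F = F ⋆ n(g)` on the block matrix -/

/-- **Maps BETWEEN lattice tensors**: `f : Y ⊗_β M → Y' ⊗_{β'} N` is `G`-equivariant (`ρ(g) ≫ f = f ≫ ρ'(g)`) iff its block matrix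
`F_{kj} = ι_j ≫ f ≫ π_k ∈ Hom(Y, Y')` satisfies **`Σ_i m(g)_{ij} • (β(g) ≫ F_{ki}) = Σ_l n(g)_{kl} • (F_{lj} ≫ β'(g))`** for all `g, k, j` —
for `β = β' = 1` the matrix identity `F m(g) = n(g) F` in `M_{κ×ι}(Hom(Y, Y'))`: `Hom_G(I ⊗ V, J ⊗ W)` is the module of `G`-invariants of
`Hom_ℤ(I, J) ⊗ Hom(V, W)`. [cite: MazurRubinSilverberg2007, Prop. 1.6 (i), (ii)] [cite: SerreLinearRepresentations1977, §1.1 and §2.3]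
[cite: MumfordAV1970, §19 (p. 173)] -/
theorem comm_iff_blocks (hb : ∑ j, b.π j ≫ b.ι j = 𝟙 b.pt) (hc : ∑ k, c.π k ≫ c.ι k = 𝟙 c.pt)
    (hρ : ∀ (g : G) (i j : ι), b.ι j ≫ End.asHom (ρ g) ≫ b.π i = m g i j • End.asHom (β g))
    (hρ' : ∀ (g : G) (k l : κ), c.ι l ≫ End.asHom (ρ' g) ≫ c.π k = n g k l • End.asHom (β' g)) (f : b.pt ⟶ c.pt) :
    (∀ g : G, End.asHom (ρ g) ≫ f = f ≫ End.asHom (ρ' g)) ↔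
      ∀ (g : G) (k : κ) (j : ι), ∑ i, m g i j • (End.asHom (β g) ≫ b.ι i ≫ f ≫ c.π k) =
        ∑ l, n g k l • ((b.ι j ≫ f ≫ c.π l) ≫ End.asHom (β' g)) := by
  rw [comm_iff_source b m β ρ ρ' hb hρ f]
  have lhs : ∀ (g : G) (k : κ) (j : ι), (∑ i, m g i j • (End.asHom (β g) ≫ b.ι i ≫ f)) ≫ c.π k =
      ∑ i, m g i j • (End.asHom (β g) ≫ b.ι i ≫ f ≫ c.π k) := by
    intro g k j
    rw [Preadditive.sum_comp]
    exact Finset.sum_congr rfl fun i _ ↦ by rw [Preadditive.zsmul_comp]; simp only [Category.assoc]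
  have rhs : ∀ (g : G) (k : κ) (j : ι), ((b.ι j ≫ f) ≫ End.asHom (ρ' g)) ≫ c.π k =
      ∑ l, n g k l • ((b.ι j ≫ f ≫ c.π l) ≫ End.asHom (β' g)) := by
    intro g k j
    rw [Category.assoc, Category.assoc, asHom_comp_π_eq_sum c n β' ρ' hc hρ' g k, Preadditive.comp_sum, Preadditive.comp_sum]
    exact Finset.sum_congr rfl fun l _ ↦ by rw [Preadditive.comp_zsmul, Preadditive.comp_zsmul]; simp only [Category.assoc]
  constructor
  · intro h g k j
    rw [← lhs, ← rhs, h g j]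
  · intro h g j
    refine hom_ext_π c hc fun k ↦ ?_
    rw [lhs, rhs, h g k j]

/-- Membership form: `f ∈ Hom_G(Y ⊗_β M, Y' ⊗_{β'} N)` (the `⨅_g eqLocus` submodule of `Motives/AbelianVarietyEquivariantHomCharacterBound`)
iff its blocks satisfy `Σ_i m(g)_{ij} • β(g) F_{ki} = Σ_l n(g)_{kl} • F_{lj} β'(g)`. [cite: MazurRubinSilverberg2007, Prop. 1.6 (ii)]
[cite: SerreLinearRepresentations1977, §2.3] -/
theorem mem_equivariantHom_iff_blocks (hb : ∑ j, b.π j ≫ b.ι j = 𝟙 b.pt) (hc : ∑ k, c.π k ≫ c.ι k = 𝟙 c.pt)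
    (hρ : ∀ (g : G) (i j : ι), b.ι j ≫ End.asHom (ρ g) ≫ b.π i = m g i j • End.asHom (β g))
    (hρ' : ∀ (g : G) (k l : κ), c.ι l ≫ End.asHom (ρ' g) ≫ c.π k = n g k l • End.asHom (β' g)) (f : b.pt ⟶ c.pt) :
    f ∈ (⨅ g : G, LinearMap.eqLocus (Preadditive.leftComp c.pt (End.asHom (ρ g))).toIntLinearMap
        (Preadditive.rightComp b.pt (End.asHom (ρ' g))).toIntLinearMap : Submodule ℤ (b.pt ⟶ c.pt)) ↔
      ∀ (g : G) (k : κ) (j : ι), ∑ i, m g i j • (End.asHom (β g) ≫ b.ι i ≫ f ≫ c.π k) =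
        ∑ l, n g k l • ((b.ι j ≫ f ≫ c.π l) ≫ End.asHom (β' g)) := by
  rw [mem_iInf_eqLocus_leftComp_rightComp_iff, comm_iff_blocks b c m n β β' ρ ρ' hb hc hρ hρ' f]

/-! ## §4 Fixed vectors give equivariant maps `y ↦ y ⊗ v` and `Σ w_i π_i` -/

omit [DecidableEq ι] in
/-- `(Σ_i v_i • ι_i) ≫ π_j = v_j • 𝟙`: the coordinates of `y ↦ y ⊗ v`. [cite: MumfordAV1970, §19 (p. 173)] -/
theorem sum_zsmul_ι_comp_π (v : ι → ℤ) (j : ι) : (∑ i, v i • b.ι i) ≫ b.π j = v j • 𝟙 Y := by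
  rw [Preadditive.sum_comp, Finset.sum_eq_single j]
  · rw [Preadditive.zsmul_comp, bicone_ι_π_self]
  · intro i _ hij
    rw [Preadditive.zsmul_comp, bicone_ι_π_ne b hij, smul_zero]
  · intro h
    exact absurd (Finset.mem_univ j) h

omit [DecidableEq ι] in
/-- `ι_j ≫ (Σ_i w_i • π_i) = w_j • 𝟙`. [cite: MumfordAV1970, §19 (p. 173)] -/
theorem ι_comp_sum_zsmul_π (w : ι → ℤ) (j : ι) : b.ι j ≫ (∑ i, w i • b.π i) = w j • 𝟙 Y := by
  rw [Preadditive.comp_sum, Finset.sum_eq_single j]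
  · rw [Preadditive.comp_zsmul, bicone_ι_π_self]
  · intro i _ hij
    rw [Preadditive.comp_zsmul, bicone_ι_π_ne b (Ne.symm hij), smul_zero]
  · intro h
    exact absurd (Finset.mem_univ j) h

/-- **Fixed vectors give equivariant maps `y ↦ y ⊗ v`**: if `m(g) v = v` for all `g` (`v ∈ M^G`), then
`F_v = Σ_i v_i • ι_i : Y → Y ⊗_β M` intertwines `β` and `ρ`: **`β(g) ≫ F_v = F_v ≫ ρ(g)`** — `M^G ⊗ V ↪ (M ⊗ V)`, e.g. the diagonal
`Y → Y ⊗ ℤ[G/H]` for `v = Σ_t e_t`. [cite: MazurRubinSilverberg2007, Cor. 1.7 (i) and Prop. 1.6 (ii)] [cite: SerreLinearRepresentations1977, §2.3 (`V^G`)]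
[cite: JordanEtAl2018, §4.1] -/
theorem comm_sum_zsmul_ι_of_mulVec_eq (hb : ∑ j, b.π j ≫ b.ι j = 𝟙 b.pt)
    (hρ : ∀ (g : G) (i j : ι), b.ι j ≫ End.asHom (ρ g) ≫ b.π i = m g i j • End.asHom (β g)) {v : ι → ℤ}
    (hv : ∀ g : G, (m g).mulVec v = v) :
    ∀ g : G, End.asHom (β g) ≫ (∑ i, v i • b.ι i) = (∑ i, v i • b.ι i) ≫ End.asHom (ρ g) := by
  rw [comm_iff_target b m β ρ β hb hρ]
  intro g i
  have hvi : ∑ j, m g i j * v j = v i := by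
    have h := congrFun (hv g) i
    simpa only [Matrix.mulVec, dotProduct] using h
  simp_rw [sum_zsmul_ι_comp_π b v, Preadditive.zsmul_comp, Preadditive.comp_zsmul, Category.id_comp, Category.comp_id,
    smul_smul, ← Finset.sum_smul, hvi]

/-- **Fixed covectors give equivariant maps `Σ_i w_i π_i`**: if `w m(g) = w` for all `g` (`w ∈ (M^∨)^G`), then
`P_w = Σ_i w_i • π_i : Y ⊗_β M → Y` intertwines `ρ` and `β`: **`ρ(g) ≫ P_w = P_w ≫ β(g)`** — e.g. the trace `Y ⊗ ℤ[G/H] → Y`,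
`w = (1, …, 1)`. [cite: MazurRubinSilverberg2007, Cor. 1.7 (i) and Prop. 1.6 (ii)] [cite: SerreLinearRepresentations1977, §2.3] [cite: JordanEtAl2018, §4.1] -/
theorem comm_sum_zsmul_π_of_vecMul_eq (hb : ∑ j, b.π j ≫ b.ι j = 𝟙 b.pt)
    (hρ : ∀ (g : G) (i j : ι), b.ι j ≫ End.asHom (ρ g) ≫ b.π i = m g i j • End.asHom (β g)) {w : ι → ℤ}
    (hw : ∀ g : G, Matrix.vecMul w (m g) = w) :
    ∀ g : G, End.asHom (ρ g) ≫ (∑ i, w i • b.π i) = (∑ i, w i • b.π i) ≫ End.asHom (β g) := by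
  rw [comm_iff_source b m β ρ β hb hρ]
  intro g j
  have hwj : ∑ i, m g i j * w i = w j := by
    have h := congrFun (hw g) j
    simp only [Matrix.vecMul, dotProduct] at h
    rw [← h]
    exact Finset.sum_congr rfl fun i _ ↦ mul_comm _ _
  simp_rw [ι_comp_sum_zsmul_π b w, Preadditive.comp_zsmul, Preadditive.zsmul_comp, Category.comp_id, Category.id_comp,
    smul_smul, ← Finset.sum_smul, hwj]

end Coordinates

end LatticeTensor

end AbelianVariety

end Literature.AlgebraicGeometry.Motives
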